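import Summits.RiemannHypothesis.RiemannHypothesis.Theorems.PfPersistenceM2EvenSectorCosineProduct
import Summits.RiemannHypothesis.RiemannHypothesis.Theorems.PfPersistenceM2EvenSectorZeroDensity
import HarnessLib

/-!
# Persistence programme, M2 even sector — `(SUM_θ) ⇒ (MULT_θ)` and the density shape
(pub-rhpf cell, M2 seat, gen 7, part 7d)

Long-odds MECHANISM SEARCH; **no RH claims**.  RH-free, kernel-checked.

Sequel to `…CosineProduct.lean` (the cosine-product theorem: `∑ 1/Im ρₖ < ∞` ⇒ one even real
compactly supported test annihilates every `ρₖ`).  Here it is applied to the quadrants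
`𝒵_θ = {ρ non-trivial zero : Re ρ ≥ 1/2 + θ, Im ρ > 0}` of the persistence programme:

* **`(SUM_θ) ⇒ (MULT_θ)`** (`quadrantMultiplier_of_summable`): if `∑_{ρ ∈ 𝒵_θ} 1/Im ρ < ∞`
  then `QuadrantMultiplier θ` (part 6/6, `…Multiplier.lean`) holds — RH-free;
* hence the trichotomy of part 6 sharpens to
  `L_n^ev ⇒ (K ≤ n ∨ ∃ θ > 0, 𝒵_θ infinite ∧ ∑_{𝒵_θ} 1/Im ρ = ∞)`
  (`encard_le_or_exists_not_summable`) and, under `(SUM_θ)` for all `θ > 0`,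
  `L_n^ev ⟺ K ≤ n` for every `n` (`forall_not_evenNegIndexAtLeast_succ_iff_of_summable`);
* **closing the even ladder** (part 7c `…ZeroDensity.lean` supplies `(SUM_θ)` for every
  `θ > 0` from the tree's pre-existing named fact `Literature.NumberTheory.LFunctions.zeroDensity_ingham`,
  Ingham 1940 = Titchmarsh Thm 9.19 (B), via the typed shape `QuadrantCountingPowerBound θ`):
  `quadrantMultiplier_of_counting` / `_of_ingham`, `quadrantAnnihilable_of_ingham`,
  `forall_not_evenNegIndexAtLeast_succ_iff_of_counting` / `_of_ingham` (`L_n^ev ⟺ K ≤ n` for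
  every `n`), `exists_evenNegIndexAtLeast_iff_of_ingham` ((∃ a, even index ≥ n at a) ⟺ n ≤ K,
  so the eventual even negative index is `K` for every `K ∈ ℕ ∪ {∞}`), and the final dichotomies
  `encard_le_or_exists_not_counting`, `encard_le_or_not_ingham`
  (`L_n^ev ⇒ K ≤ n ∨ ¬zeroDensity_ingham`).

Net state of the even ladder after gen 7: every level `n ≥ 0` is kernel-PROVED (RH-free) MODULO
EXACTLY ONE named Literature fact vendored before this cell, `zeroDensity_ingham`, used as the
hypothesis `(h : zeroDensity_ingham)`; level `0` is RH itself (`L_0^ev ⟺ RH`, earlier parts);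
unconditionally `K ≥ n+1 ⇒ ¬L_n^ev ⇒ (K ≥ n+1 ∨ ∃ θ > 0, ∑_{𝒵_θ} 1/Im ρ = ∞)`.
Labels: PROVED = kernel; CITED = `zeroDensity_ingham` (not kernel-proved; nothing minted here).
-/

noncomputable section
set_option linter.dupNamespace false

open Complex Filter Set MeasureTheory
open scoped Real Topology

namespace Summit.RiemannHypothesis.RiemannHypothesis.Theorems.PfPersistenceM2NegIndex

open Literature.NumberTheory.LFunctions
open Literature.NumberTheory.LFunctions.ZetaZeros

/-! ## 1. `(SUM_θ) ⇒ (MULT_θ)` and the sharpened trichotomy -/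

/-- **`(SUM_θ) ⇒ (MULT_θ)` (PROVED, RH-free).**  If `∑_{ρ ∈ 𝒵_θ} 1/Im ρ < ∞` over the quadrant
`𝒵_θ = {ρ non-trivial zero : Re ρ ≥ 1/2 + θ, Im ρ > 0}` (`θ > 0`), then `QuadrantMultiplier θ`:
one even real compactly supported test annihilates all of `𝒵_θ`.  Finite `𝒵_θ`: parts 5/6
(`quadrantMultiplier_of_annihilable ∘ quadrantAnnihilable_of_finite`); infinite `𝒵_θ`: the
cosine-product theorem. [folklore] -/
theorem quadrantMultiplier_of_summable {θ : ℝ} (hθ : 0 < θ)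
    (hsum : Summable fun ρ : ↥{ρ : ℂ | ρ ∈ riemannZetaNontrivialZeros ∧ 1 / 2 + θ ≤ ρ.re ∧
      0 < ρ.im} ↦ 1 / (ρ : ℂ).im) :
    QuadrantMultiplier θ := by
  by_cases hfin : {ρ : ℂ | ρ ∈ riemannZetaNontrivialZeros ∧ 1 / 2 + θ ≤ ρ.re ∧ 0 < ρ.im}.Finite
  · exact quadrantMultiplier_of_annihilable hθ (quadrantAnnihilable_of_finite hθ hfin)
  intro _
  obtain ⟨φ, b, hφ, hev, hre, hφs, hne, hvan⟩ :=
    CosineProduct.exists_evenRealTest_weilMellin_vanish_of_summable_set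
      (fun ρ hρ ↦ hρ.2.2) hfin hsum
  exact ⟨φ, b, hφ, hev, hre, hφs, Function.ne_iff.mpr ⟨1 / 2, hne⟩, hvan⟩

/-- **Sharpened trichotomy (PROVED, RH-free):** `L_n^ev` forces `K ≤ n` unless, for some
`θ > 0`, the quadrant `𝒵_θ` is infinite with `∑_{𝒵_θ} 1/Im ρ = ∞` (a failure of every
zero-density estimate `N(1/2+θ, T) ≪ T^{1-c}`). [folklore] -/
theorem encard_le_or_exists_not_summable (n : ℕ) (hno : ∀ a : ℝ, ¬ EvenNegIndexAtLeast (n + 1) a) :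
    {ρ : ℂ | ρ ∈ riemannZetaNontrivialZeros ∧ 1 / 2 < ρ.re ∧ 0 < ρ.im}.encard ≤ n ∨
      ∃ θ : ℝ, 0 < θ ∧
        {ρ : ℂ | ρ ∈ riemannZetaNontrivialZeros ∧ 1 / 2 + θ ≤ ρ.re ∧ 0 < ρ.im}.Infinite ∧
        ¬ Summable fun ρ : ↥{ρ : ℂ | ρ ∈ riemannZetaNontrivialZeros ∧ 1 / 2 + θ ≤ ρ.re ∧
            0 < ρ.im} ↦ 1 / (ρ : ℂ).im := by
  rcases encard_le_or_exists_not_multiplier n hno with h | ⟨θ, hθ, hinf, hnm⟩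
  · exact Or.inl h
  · exact Or.inr ⟨θ, hθ, hinf, fun hs ↦ hnm (quadrantMultiplier_of_summable hθ hs)⟩

/-- **`L_n^ev ⟺ K ≤ n` under `(SUM_θ)` for all `θ > 0` (PROVED, RH-free)** — in particular
under any zero-density hypothesis `N(σ, T) ≪ T^{1 - c(σ)} log T` for `σ > 1/2`
(Carlson; HYPOTHESIS here, CITED: Titchmarsh Thm 9.17). [folklore] -/
theorem forall_not_evenNegIndexAtLeast_succ_iff_of_summable
    (hS : ∀ θ : ℝ, 0 < θ → Summable fun ρ : ↥{ρ : ℂ | ρ ∈ riemannZetaNontrivialZeros ∧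
      1 / 2 + θ ≤ ρ.re ∧ 0 < ρ.im} ↦ 1 / (ρ : ℂ).im) (n : ℕ) :
    (∀ a : ℝ, ¬ EvenNegIndexAtLeast (n + 1) a) ↔
      {ρ : ℂ | ρ ∈ riemannZetaNontrivialZeros ∧ 1 / 2 < ρ.re ∧ 0 < ρ.im}.encard ≤ n :=
  forall_not_evenNegIndexAtLeast_succ_iff_of_multiplier
    (fun θ hθ ↦ quadrantMultiplier_of_summable hθ (hS θ hθ)) n

/-! ## 2. Closing the even ladder from the counting shape / Ingham's theorem -/

/-- **Density shape ⇒ `(MULT_θ)` (PROVED, RH-free).** [folklore] -/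
theorem quadrantMultiplier_of_counting {θ : ℝ} (hθ : 0 < θ)
    (h : QuadrantCountingPowerBound θ) : QuadrantMultiplier θ :=
  quadrantMultiplier_of_summable hθ (summable_inv_im_quadrant_of_counting h)

/-- **Trichotomy against the density shape (PROVED, RH-free):** `L_n^ev` forces `K ≤ n`
unless some quadrant `𝒵_θ` (`θ > 0`) is infinite AND violates the power-saving counting shape
`QuadrantCountingPowerBound θ` — i.e. unless the classical zero-density theorem fails at
`σ = 1/2 + θ`. [folklore] -/
theorem encard_le_or_exists_not_counting (n : ℕ) (hno : ∀ a : ℝ, ¬ EvenNegIndexAtLeast (n + 1) a) :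
    {ρ : ℂ | ρ ∈ riemannZetaNontrivialZeros ∧ 1 / 2 < ρ.re ∧ 0 < ρ.im}.encard ≤ n ∨
      ∃ θ : ℝ, 0 < θ ∧
        {ρ : ℂ | ρ ∈ riemannZetaNontrivialZeros ∧ 1 / 2 + θ ≤ ρ.re ∧ 0 < ρ.im}.Infinite ∧
        ¬ QuadrantCountingPowerBound θ := by
  rcases encard_le_or_exists_not_summable n hno with h | ⟨θ, hθ, hinf, hns⟩
  · exact Or.inl h
  · exact Or.inr ⟨θ, hθ, hinf, fun hc ↦ hns (summable_inv_im_quadrant_of_counting hc)⟩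

/-- **`L_n^ev ⟺ K ≤ n` for every `n`, under the density-shape hypothesis for all `θ > 0`
(PROVED, RH-free; the hypothesis is the classical zero-density theorem, not formalised).**
[folklore] -/
theorem forall_not_evenNegIndexAtLeast_succ_iff_of_counting
    (hD : ∀ θ : ℝ, 0 < θ → QuadrantCountingPowerBound θ) (n : ℕ) :
    (∀ a : ℝ, ¬ EvenNegIndexAtLeast (n + 1) a) ↔
      {ρ : ℂ | ρ ∈ riemannZetaNontrivialZeros ∧ 1 / 2 < ρ.re ∧ 0 < ρ.im}.encard ≤ n :=
  forall_not_evenNegIndexAtLeast_succ_iff_of_summable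
    (fun θ hθ ↦ summable_inv_im_quadrant_of_counting (hD θ hθ)) n

/-- **Ingham ⇒ `(MULT_θ)` for every `θ > 0` (PROVED modulo the named fact):** the quadrant `𝒵_θ`
lies in the zero set of the Mellin transform of ONE non-zero even real test function of compact
support (the cosine product of parts 7a–7c). [folklore] -/
theorem quadrantMultiplier_of_ingham (h : zeroDensity_ingham) {θ : ℝ} (hθ : 0 < θ) :
    QuadrantMultiplier θ :=
  quadrantMultiplier_of_counting hθ (quadrantCountingPowerBound_of_ingham h hθ)

/-- **Ingham ⇒ `(QA_θ)` for every `θ > 0` (PROVED modulo the named fact).** [folklore] -/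
theorem quadrantAnnihilable_of_ingham (h : zeroDensity_ingham) {θ : ℝ} (hθ : 0 < θ) :
    QuadrantAnnihilable θ :=
  quadrantAnnihilable_of_multiplier hθ (quadrantMultiplier_of_ingham h hθ)

/-- **THE EVEN LADDER CLOSED modulo Ingham's zero-density theorem (PROVED, RH-free): for every
`n ≥ 0`, `L_n^ev ⟺ K ≤ n`** — the even real Weil form has negative index `≤ n` on every window
iff there are at most `n` zeros in the open quadrant `Re ρ > 1/2, Im ρ > 0` (`K = ∞` allowed, in
which case both sides fail).  The only non-kernel input is the tree's named fact
`zeroDensity_ingham` (Ingham 1940 / Titchmarsh Thm 9.19 (B)). [folklore] -/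
theorem forall_not_evenNegIndexAtLeast_succ_iff_of_ingham (h : zeroDensity_ingham) (n : ℕ) :
    (∀ a : ℝ, ¬ EvenNegIndexAtLeast (n + 1) a) ↔
      {ρ : ℂ | ρ ∈ riemannZetaNontrivialZeros ∧ 1 / 2 < ρ.re ∧ 0 < ρ.im}.encard ≤ n :=
  forall_not_evenNegIndexAtLeast_succ_iff_of_counting
    (fun _ hθ ↦ quadrantCountingPowerBound_of_ingham h hθ) n

/-- **Eventual even negative index `= K` for every `K ∈ ℕ ∪ {∞}`, modulo Ingham (PROVED,
RH-free):** an `n`-dimensional negative-definite even real family exists on some window iff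
`n ≤ K`. [folklore] -/
theorem exists_evenNegIndexAtLeast_iff_of_ingham (h : zeroDensity_ingham) (n : ℕ) :
    (∃ a : ℝ, EvenNegIndexAtLeast n a) ↔
      (n : ℕ∞) ≤ {ρ : ℂ | ρ ∈ riemannZetaNontrivialZeros ∧ 1 / 2 < ρ.re ∧ 0 < ρ.im}.encard :=
  exists_evenNegIndexAtLeast_iff_of_annihilable (fun _ hθ ↦ quadrantAnnihilable_of_ingham h hθ) n

/-- **Final dichotomy (PROVED, RH-free):** `L_n^ev` forces `K ≤ n` — unless Ingham's zero-density
theorem (the named fact `zeroDensity_ingham`) is false. [folklore] -/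
theorem encard_le_or_not_ingham (n : ℕ) (hno : ∀ a : ℝ, ¬ EvenNegIndexAtLeast (n + 1) a) :
    {ρ : ℂ | ρ ∈ riemannZetaNontrivialZeros ∧ 1 / 2 < ρ.re ∧ 0 < ρ.im}.encard ≤ n ∨
      ¬ zeroDensity_ingham := by
  rcases encard_le_or_exists_not_counting n hno with hK | ⟨θ, hθ, -, hnc⟩
  · exact Or.inl hK
  · exact Or.inr fun h ↦ hnc (quadrantCountingPowerBound_of_ingham h hθ)

end Summit.RiemannHypothesis.RiemannHypothesis.Theorems.PfPersistenceM2NegIndex
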